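import Summits.AnomalousDissipation.AnomalousDissipation.Theorems.TwoAndHalfDTwohalfdThesisStubStrainGate
import Summits.AnomalousDissipation.AnomalousDissipation.Theorems.TwoAndHalfDTwohalfdThesisStubWeakDuhamel
import Literature.Analysis.FluidPDE.LongTimeAverageSlidingWindow

/-!
# The strain gate read in W's format (line `Sketch`, crux stmt-AnomalousDissipation-0206)

Helper file of the line `Sketch` (duhamel-release) for the crux
`Summit.AnomalousDissipation.AnomalousDissipation.Theses.TwoAndHalfD.TwohalfdThesis`
(stmt-AnomalousDissipation-0206), supporting the registered kernel `stub_releasedMixingWitness` (W):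
consequences of the strain gate G1 (`strainGate_of_loss`, `…StubStrainGate.lean`) for the released
families of W.

* `exists_pos_lag_le_half` — an integrable nonnegative envelope `Λ` on `[0, ∞)` has a LOSSY LAG:
  some `τ₀ > 0` with `Λ(τ₀) ≤ 1/2` (else `Λ > 1/2` on `(0, ∞)`, not integrable).
* `releasedFamily_logStrain` — W's format: classical releases `φ j s` of one smooth `h` into the drifts
  `v j` at every time `s ≥ 0`, losing the fraction `δ` of `‖h‖²` by age `τ₀` from every release time
  `s ≥ s₀`; then there are `κ₀ ∈ (0,1)`, `C ≥ 0` with: for every `j` with `ν_j ≤ κ₀`, every `s ≥ s₀` and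
  every budget `S` of the window strain `∫_s^{s+τ₀}‖∇v_j‖_{L²}`, `δ‖h‖²·log(1/ν_j) ≤ C(S+1)`.
* `releasedFamily_windowStrain_ge` — the same as a floor in `[0, ∞]`:
  `ofReal(δ‖h‖² log(1/ν_j)/C − 1) ≤ ∫⁻_{(0,τ₀)} (‖∇v_j(s+τ)‖₂²)^{1/2} dτ` on EVERY late window — the
  input of the windows-to-mean bookkeeping G2 (mean strain `≳ log(1/ν_j)/τ₀`, mean enstrophy
  `≳ log²(1/ν_j)/τ₀²`: the exact threshold below which the sibling crux `TwohalfdNeg`'s landed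
  `stub_quietOfSubLog` kills `X`).
* `stub_witnessStrainGate` — the registered statement (= `releasedFamily_windowStrain_ge` with explicit binders).
* `releaseEnvelope_false_of_strainBudget` — the STRAIN-BUDGET LOG GATE: a `j`-uniform loss on one window
  is impossible along `ν_j → 0` under a `j`-uniform window-strain budget `∫_s^{s+τ₀}‖∇v_j‖_{L²} ≤ S`;
  strictly stronger than the landed log gate `releaseEnvelope_false_of_gradient_bound` (p91755), whose
  pointwise bound `‖∂ᵢv_j‖ ≤ L` gives such a budget.

All proofs: time shift `t ↦ t + s` of the release (autonomous equation,
`isClassicalScalarTransportOn_comp_add_const`), restriction to `[0, τ₀]`, G1, and `log(1/ν_j) → ∞`.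
Supports stmt-AnomalousDissipation-0206. [folklore: Crippa–De Lellis 2008; Seis 2022; Batchelor 1959]
-/

noncomputable section

-- the summit path `AnomalousDissipation/AnomalousDissipation` duplicates a namespace component
set_option linter.dupNamespace false

namespace Summit.AnomalousDissipation.AnomalousDissipation.Theorems.TwohalfdThesis

open MeasureTheory Set Filter Topology
open scoped ENNReal NNReal InnerProductSpace
open Literature.Analysis.FunctionSpaces Literature.Analysis.FluidPDE

/-! ## A lossy lag exists -/

/-- **An integrable nonnegative envelope has a lossy lag**: if `Λ ≥ 0` is integrable on `[0, ∞)` then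
`Λ(τ₀) ≤ 1/2` for some `τ₀ > 0` (otherwise the constant `1/2` would be integrable on `(0, ∞)`). [folklore] -/
theorem exists_pos_lag_le_half {Λ : ℝ → ℝ} (hΛi : IntegrableOn Λ (Ici 0)) :
    ∃ τ₀ : ℝ, 0 < τ₀ ∧ Λ τ₀ ≤ 1 / 2 := by
  by_contra hcon
  push Not at hcon
  have hconst : IntegrableOn (fun _ : ℝ => (1 / 2 : ℝ)) (Ioi 0) := by
    refine Integrable.mono' (hΛi.mono_set Ioi_subset_Ici_self) aestronglyMeasurable_const ?_
    refine (ae_restrict_iff' measurableSet_Ioi).2 (Eventually.of_forall fun τ hτ => ?_)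
    rw [Real.norm_eq_abs, abs_of_pos (by norm_num : (0 : ℝ) < 1 / 2)]
    exact (hcon τ hτ).le
  have h := (integrableOn_const_iff (C := (1 / 2 : ℝ))).1 hconst
  rcases h with h | h
  · rw [enorm_eq_zero] at h
    norm_num at h
  · rw [Real.volume_Ioi] at h
    exact absurd h (lt_irrefl _)

/-! ## The strain gate along a released family (W's format) -/

section Family

variable {ν : ℕ → ℝ} {v : ℕ → ℝ → UnitAddTorus (Fin 2) → EuclideanSpace ℝ (Fin 2)}
  {h : UnitAddTorus (Fin 2) → ℝ} {φ : ℕ → ℝ → ℝ → UnitAddTorus (Fin 2) → ℝ} {s₀ τ₀ δ : ℝ}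

/-- **Released families pay logarithmic strain for every late loss (W's format).**  Let `φ j s` be
classical releases of one smooth pattern `h` at every time `s ≥ 0` into the drifts `v j`
(`∂ₜφ + v_j·∇φ = ν_jΔφ` on `[s, ∞)`, `φ j s s = h`), losing the fraction `δ` of `‖h‖²` by age `τ₀ > 0`
from every release time `s ≥ s₀`: `‖φ j s (s + τ₀)‖² ≤ (1 − δ)‖h‖²`.  Then there are `κ₀ ∈ (0,1)` and
`C ≥ 0` (depending on `h`, `τ₀` only) such that for every `j` with `ν_j ≤ κ₀`, every `s ≥ s₀` and every
window-strain budget `∫_s^{s+τ₀}‖∇v_j‖_{L²} ≤ S`: `δ‖h‖²·log(1/ν_j) ≤ C(S+1)`.  (Time shift of the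
release to `[0, τ₀]`, then G1 `strainGate_of_loss`.) [folklore] -/
theorem releasedFamily_logStrain (hν : ∀ j, 0 < ν j) (hh : Torus.IsSmooth h) (hτ₀ : 0 < τ₀)
    (hrel : ∀ j s, 0 ≤ s → Torus.IsClassicalScalarTransportOn (Ici s) (ν j) (v j) (φ j s) ∧ φ j s s = h)
    (hs₀ : 0 ≤ s₀)
    (hloss : ∀ j s, s₀ ≤ s → Torus.scalarL2Sq (φ j s (s + τ₀)) ≤ (1 - δ) * Torus.scalarL2Sq h) :
    ∃ κ₀ C : ℝ, 0 < κ₀ ∧ κ₀ < 1 ∧ 0 ≤ C ∧ ∀ j, ν j ≤ κ₀ → ∀ s, s₀ ≤ s → ∀ S, 0 ≤ S →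
      ∫⁻ τ in Ioo 0 τ₀, Torus.eGradNormSq (v j (s + τ)) ^ (1 / 2 : ℝ) ≤ ENNReal.ofReal S →
      δ * Torus.scalarL2Sq h * Real.log (ν j)⁻¹ ≤ C * (S + 1) := by
  obtain ⟨κ₀, C, hκ₀, hκ₀1, hC, hgate⟩ := strainGate_of_loss (d := Fin 2) hh hτ₀
  refine ⟨κ₀, C, hκ₀, hκ₀1, hC, fun j hj s hs S hS hstrain => ?_⟩
  have hs0 : 0 ≤ s := hs₀.trans hs
  obtain ⟨hφ, hφs⟩ := hrel j s hs0
  -- shift the release at time `s` to `[0, ∞)` and restrict to `[0, τ₀]`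
  have hshift := isClassicalScalarTransportOn_comp_add_const hφ s
  rw [Set.preimage_add_const_Ici, sub_self] at hshift
  have hwin : Torus.IsClassicalScalarTransportOn (Icc 0 τ₀) (ν j) (fun σ => v j (σ + s))
      (fun σ => φ j s (σ + s)) := hshift.restrict_Icc hτ₀ Icc_subset_Ici_self
  have h0 : (fun σ => φ j s (σ + s)) 0 = h := by simp only [zero_add]; exact hφs
  have hstrain' : ∫⁻ t in Ioo 0 τ₀, Torus.eGradNormSq ((fun σ => v j (σ + s)) t) ^ (1 / 2 : ℝ) ≤
      ENNReal.ofReal S := by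
    simp only [add_comm _ s]
    exact hstrain
  have hG := hgate (ν j) S (fun σ => v j (σ + s)) (fun σ => φ j s (σ + s)) (hν j) hj hS hwin h0 hstrain'
  simp only [add_comm τ₀ s] at hG
  -- `δ‖h‖² ≤ ‖h‖² − ‖φ j s (s + τ₀)‖²`, and `log(1/ν_j) > 0`
  have hlog : 0 < Real.log (ν j)⁻¹ := Real.log_pos ((one_lt_inv₀ (hν j)).2 (hj.trans_lt hκ₀1))
  have hδ : δ * Torus.scalarL2Sq h ≤ Torus.scalarL2Sq h - Torus.scalarL2Sq (φ j s (s + τ₀)) := by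
    have := hloss j s hs
    linarith
  calc δ * Torus.scalarL2Sq h * Real.log (ν j)⁻¹
      ≤ (Torus.scalarL2Sq h - Torus.scalarL2Sq (φ j s (s + τ₀))) * Real.log (ν j)⁻¹ :=
        mul_le_mul_of_nonneg_right hδ hlog.le
    _ ≤ C * (S + 1) := hG

/-- **Every late window of every low-viscosity member carries logarithmic strain** (the floor form of
`releasedFamily_logStrain` in `[0, ∞]`, input of the windows-to-mean bookkeeping G2): under the same
hypotheses there are `κ₀ ∈ (0,1)` and `C > 0` with
`ofReal(δ‖h‖²·log(1/ν_j)/C − 1) ≤ ∫⁻_{(0,τ₀)} (‖∇v_j(s+τ)‖₂²)^{1/2} dτ` for all `j` with `ν_j ≤ κ₀` and all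
`s ≥ s₀`. [folklore] -/
theorem releasedFamily_windowStrain_ge (hν : ∀ j, 0 < ν j) (hh : Torus.IsSmooth h) (hτ₀ : 0 < τ₀)
    (hrel : ∀ j s, 0 ≤ s → Torus.IsClassicalScalarTransportOn (Ici s) (ν j) (v j) (φ j s) ∧ φ j s s = h)
    (hs₀ : 0 ≤ s₀)
    (hloss : ∀ j s, s₀ ≤ s → Torus.scalarL2Sq (φ j s (s + τ₀)) ≤ (1 - δ) * Torus.scalarL2Sq h) :
    ∃ κ₀ C : ℝ, 0 < κ₀ ∧ κ₀ < 1 ∧ 0 < C ∧ ∀ j, ν j ≤ κ₀ → ∀ s, s₀ ≤ s →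
      ENNReal.ofReal (δ * Torus.scalarL2Sq h * Real.log (ν j)⁻¹ / C - 1) ≤
        ∫⁻ τ in Ioo 0 τ₀, Torus.eGradNormSq (v j (s + τ)) ^ (1 / 2 : ℝ) := by
  obtain ⟨κ₀, C, hκ₀, hκ₀1, hC, hmain⟩ := releasedFamily_logStrain hν hh hτ₀ hrel hs₀ hloss
  refine ⟨κ₀, C + 1, hκ₀, hκ₀1, by linarith, fun j hj s hs => ?_⟩
  set W := ∫⁻ τ in Ioo 0 τ₀, Torus.eGradNormSq (v j (s + τ)) ^ (1 / 2 : ℝ) with hW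
  rcases eq_or_ne W ∞ with hWt | hWt
  · rw [hWt]; exact le_top
  have hWS : W ≤ ENNReal.ofReal W.toReal := by rw [ENNReal.ofReal_toReal hWt]
  have h1 := hmain j hj s hs W.toReal ENNReal.toReal_nonneg hWS
  have hC1 : (0 : ℝ) < C + 1 := by linarith
  have h2 : δ * Torus.scalarL2Sq h * Real.log (ν j)⁻¹ ≤ (C + 1) * (W.toReal + 1) := by
    have : C * (W.toReal + 1) ≤ (C + 1) * (W.toReal + 1) :=
      mul_le_mul_of_nonneg_right (by linarith) (by positivity)
    linarith
  have h3 : δ * Torus.scalarL2Sq h * Real.log (ν j)⁻¹ / (C + 1) - 1 ≤ W.toReal := by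
    rw [sub_le_iff_le_add, div_le_iff₀ hC1]
    linarith
  calc ENNReal.ofReal (δ * Torus.scalarL2Sq h * Real.log (ν j)⁻¹ / (C + 1) - 1)
      ≤ ENNReal.ofReal W.toReal := ENNReal.ofReal_le_ofReal h3
    _ = W := ENNReal.ofReal_toReal hWt

end Family

/-! ## The strain-budget log gate -/

/-- `log(1/ν_j) → +∞` along `ν_j → 0⁺`. [folklore] -/
theorem tendsto_log_inv_atTop_of_tendsto_zero {ν : ℕ → ℝ} (hν : ∀ j, 0 < ν j)
    (hν0 : Tendsto ν atTop (𝓝 0)) : Tendsto (fun j => Real.log (ν j)⁻¹) atTop atTop := by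
  have hν0' : Tendsto ν atTop (𝓝[>] 0) :=
    tendsto_nhdsWithin_iff.2 ⟨hν0, Eventually.of_forall fun j => hν j⟩
  exact Real.tendsto_log_atTop.comp (tendsto_inv_nhdsGT_zero.comp hν0')

/-- **The strain-budget log gate** (strengthening of the landed log gate
`releaseEnvelope_false_of_gradient_bound` from pointwise to `L¹ₜL²ₓ` gradient bounds).  Let `v_j` be
smooth divergence-free drifts on a window `[s, s + τ₀] × T²` with a `j`-UNIFORM window-strain budget
`∫_s^{s+τ₀}‖∇v_j(t)‖_{L²} dt ≤ S`, and `φ_j` the classical releases of one smooth pattern `h ≠ 0` into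
`v_j` with diffusivities `ν_j → 0⁺` (`φ_j(s) = h`).  Then a `j`-uniform loss of a fixed fraction of `L²`
energy on the window, `‖φ_j(s + τ₀)‖² ≤ (1 − δ)‖h‖²` for all `j` (`δ > 0`), is impossible:
by G1, `δ‖h‖² log(1/ν_j) ≤ C(S+1)` for `ν_j ≤ κ₀`, while `log(1/ν_j) → ∞`. [folklore] -/
theorem releaseEnvelope_false_of_strainBudget (ν : ℕ → ℝ)
    (v : ℕ → ℝ → UnitAddTorus (Fin 2) → EuclideanSpace ℝ (Fin 2)) (h : UnitAddTorus (Fin 2) → ℝ)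
    (φ : ℕ → ℝ → UnitAddTorus (Fin 2) → ℝ) (S s τ₀ δ : ℝ) (hν : ∀ j, 0 < ν j)
    (hν0 : Tendsto ν atTop (𝓝 0)) (hh : Torus.IsSmooth h) (hh0 : 0 < Torus.scalarL2Sq h) (hτ₀ : 0 < τ₀)
    (hδ : 0 < δ) (hS : 0 ≤ S)
    (hrel : ∀ j, Torus.IsClassicalScalarTransportOn (Icc s (s + τ₀)) (ν j) (v j) (φ j) ∧ φ j s = h)
    (hbudget : ∀ j, ∫⁻ t in Ioo s (s + τ₀), Torus.eGradNormSq (v j t) ^ (1 / 2 : ℝ) ≤ ENNReal.ofReal S)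
    (hloss : ∀ j, Torus.scalarL2Sq (φ j (s + τ₀)) ≤ (1 - δ) * Torus.scalarL2Sq h) : False := by
  obtain ⟨κ₀, C, hκ₀, hκ₀1, hC, hgate⟩ := strainGate_of_loss (d := Fin 2) hh hτ₀
  -- the bound `δ‖h‖² log(1/ν_j) ≤ C(S+1)` for `ν_j ≤ κ₀`
  have hbound : ∀ j, ν j ≤ κ₀ → δ * Torus.scalarL2Sq h * Real.log (ν j)⁻¹ ≤ C * (S + 1) := by
    intro j hj
    obtain ⟨hφ, hφs⟩ := hrel j
    have hshift := isClassicalScalarTransportOn_comp_add_const hφ s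
    rw [Set.preimage_add_const_Icc, sub_self, add_sub_cancel_left] at hshift
    have h0 : (fun σ => φ j (σ + s)) 0 = h := by simp only [zero_add]; exact hφs
    have hstrain' : ∫⁻ t in Ioo 0 τ₀, Torus.eGradNormSq ((fun σ => v j (σ + s)) t) ^ (1 / 2 : ℝ) ≤
        ENNReal.ofReal S := by
      have e := setLIntegral_Ioo_add_right (fun t => Torus.eGradNormSq (v j t) ^ (1 / 2 : ℝ)) 0 τ₀ s
      simp only [zero_add] at e
      simp only [e, add_comm τ₀ s]
      exact hbudget j
    have hG := hgate (ν j) S (fun σ => v j (σ + s)) (fun σ => φ j (σ + s)) (hν j) hj hS hshift h0 hstrain'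
    simp only [add_comm τ₀ s] at hG
    have hlog : 0 < Real.log (ν j)⁻¹ := Real.log_pos ((one_lt_inv₀ (hν j)).2 (hj.trans_lt hκ₀1))
    have hδ' : δ * Torus.scalarL2Sq h ≤ Torus.scalarL2Sq h - Torus.scalarL2Sq (φ j (s + τ₀)) := by
      have := hloss j
      linarith
    calc δ * Torus.scalarL2Sq h * Real.log (ν j)⁻¹
        ≤ (Torus.scalarL2Sq h - Torus.scalarL2Sq (φ j (s + τ₀))) * Real.log (ν j)⁻¹ :=
          mul_le_mul_of_nonneg_right hδ' hlog.le
      _ ≤ C * (S + 1) := hG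
  -- but `log(1/ν_j) → ∞`
  have hpos : 0 < δ * Torus.scalarL2Sq h := mul_pos hδ hh0
  have hev1 : ∀ᶠ j in atTop, ν j ≤ κ₀ := hν0.eventually_le_const hκ₀
  have hev2 : ∀ᶠ j in atTop, C * (S + 1) / (δ * Torus.scalarL2Sq h) + 1 ≤ Real.log (ν j)⁻¹ :=
    (tendsto_log_inv_atTop_of_tendsto_zero hν hν0).eventually_ge_atTop _
  obtain ⟨j, hj1, hj2⟩ := (hev1.and hev2).exists
  have h1 := hbound j hj1
  have h2 : C * (S + 1) + δ * Torus.scalarL2Sq h ≤ δ * Torus.scalarL2Sq h * Real.log (ν j)⁻¹ := by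
    have := mul_le_mul_of_nonneg_left hj2 hpos.le
    rw [mul_add, mul_one, mul_div_cancel₀ _ hpos.ne'] at this
    exact this
  linarith

/-! ## The registered statement -/

/-- **G1-W `stub_witnessStrainGate` (line `Sketch` = duhamel-release, crux `TwoAndHalfD.TwohalfdThesis`;
registered signature) — every late window of every low-viscosity member of a released family with a late
loss carries logarithmic strain** (`releasedFamily_windowStrain_ge` with explicit binders). [folklore] -/
theorem stub_witnessStrainGate :
    ∀ (ν : ℕ → ℝ) (v : ℕ → ℝ → (UnitAddTorus (Fin 2)) → (EuclideanSpace ℝ (Fin 2))) (h : (UnitAddTorus (Fin 2)) → ℝ) (φ : ℕ → ℝ → ℝ → (UnitAddTorus (Fin 2)) → ℝ) (s₀ τ₀ δ : ℝ),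
      (∀ j, 0 < ν j) → Torus.IsSmooth h → 0 < τ₀ →
      (∀ j s, 0 ≤ s → Torus.IsClassicalScalarTransportOn (Ici s) (ν j) (v j) (φ j s) ∧ φ j s s = h) →
      0 ≤ s₀ →
      (∀ j s, s₀ ≤ s → Torus.scalarL2Sq (φ j s (s + τ₀)) ≤ (1 - δ) * Torus.scalarL2Sq h) →
      ∃ κ₀ C : ℝ, 0 < κ₀ ∧ κ₀ < 1 ∧ 0 < C ∧ ∀ j, ν j ≤ κ₀ → ∀ s, s₀ ≤ s →
        ENNReal.ofReal (δ * Torus.scalarL2Sq h * Real.log (ν j)⁻¹ / C - 1) ≤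
          ∫⁻ τ in Ioo 0 τ₀, Torus.eGradNormSq (v j (s + τ)) ^ (1 / 2 : ℝ) :=
  fun _ν _v _h _φ _s₀ _τ₀ _δ hν hh hτ₀ hrel hs₀ hloss => releasedFamily_windowStrain_ge hν hh hτ₀ hrel hs₀ hloss

end Summit.AnomalousDissipation.AnomalousDissipation.Theorems.TwohalfdThesis

end
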